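import Literature.AlgebraicGeometry.HodgeTheory.ClassesSupportedOn
import Literature.AlgebraicGeometry.HodgeTheory.GysinFormalism
import Literature.AlgebraicGeometry.Motives.FamiliesVHS
import HarnessLib

/-!
# Specialisation of the cycle class of a flat family of subschemes (Fulton 1998, Ch. 10 and Ch. 19) — named fact

Family `hodge`, layer `Literature/AlgebraicGeometry/HodgeTheory`. Requested by the line
`Cruxes/VariationalHodge/Lines/polar_patch_broken_cycles.lean` of crux `stmt-HodgeConjecture-1076`
(Grothendieck's variational Hodge conjecture), stub `stub_flatFamilyCycleClass` (lead's reshape gen 2,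
2026-08-17): it is exactly the classical input that the stub `stub_flatFamilyCarriesClass` ("a flat family
of codimension-`p` subschemes carries the anchored class") was found to be blocked on (S2 worker, wave 1:
"specialisation of the cycle class of a flat family on `complexBetti` WITH multiplicities — no decl in
tree; nearest existing `fulton1998_map_mem_algebraicClasses`, membership only").

## Sources

* [Fulton1998] W. Fulton, *Intersection Theory*, 2nd ed. (1998). Ch. 10 "Families of algebraic cycles",
  §10.1: for a scheme `𝒳` over a base `T` and a regular (closed) point `t`, the specialisation
  `σ_t : A_k(𝒳) → A_{k-m}(X_t)` is the refined Gysin map of the regular embedding `t ↪ T`;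
  Prop. 10.1 (a): if `𝒱 ⊆ 𝒳` is a closed subscheme FLAT over `T`, then `σ_t[𝒱] = [𝒱_t]`, the
  fundamental cycle of the scheme-theoretic fibre — a POSITIVE combination `Σ_D m_D [D]` of its
  irreducible components `D`, `m_D = length(𝒪_{𝒱_t, D}) ≥ 1` (§1.5); Cor. 10.1 ("principle of
  continuity"). Ch. 19 "Algebraic, homological and numerical equivalence", §19.1 eq. (1) and
  Lemma 19.1.1: for `Z ⊆ X` closed in the non-singular `n`-dimensional `X`, of dimension `k`,
  `H^{2n-2k}(X, X ∖ Z) ≅ H^{BM}_{2k}(Z)` is freely spanned by the classes of the `k`-dimensional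
  components of `Z` and vanishes above; the cycle class `cl(Z) ∈ H^{2n-2k}(X)` is the image of the
  fundamental class and is supported on `Z`; §19.2, Cor. 19.2 (b) and Example 19.2.1:
  `cl : A_*(X) → H_*(X)` is compatible with refined Gysin homomorphisms of regular embeddings, in
  particular with `σ_t` along the regular embedding `X_t ↪ 𝒳` of a fibre of a smooth morphism:
  `i_t^* cl(𝒱) = cl(σ_t[𝒱]) = cl([𝒱_t])`.
* [BuchweitzFlenner2003] R.-O. Buchweitz, H. Flenner, Compositio Math. 137 (2003) = arXiv:math/9912245,
  §5, end of the proof of Thm. 5.1 / Thm. 5.2: "the uniqueness of the horizontal lifting gives that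
  `α_p = ch_p(…)` … Hence `α_p(s) = ch_p(…|X_s)` is algebraic for all `s ∈ S` near `0`" — the use of
  this fact in the variational Hodge setting (the classes of the fibres of the `S`-flat family are the
  restrictions of ONE class on the total space).
* [VoisinHodgeII2003] C. Voisin, *Hodge Theory and Complex Algebraic Geometry II* (2003), §9.2
  (Prop. 9.21ff: the classes of the fibres of a flat family of cycles give a flat section of
  `R^{2p} π_* ℤ`).

## Rendering on the tree's real carriers (no cycle class map is available)

The tree has no cycle class map `cl : Z^p(X) → H^{2p}(X(ℂ); ℂ)` for subschemes of a family (only the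
hypothesis structure `GysinFormalism`, and `complexGysin`/`primeClass` on a single smooth projective
variety); the fact is therefore rendered by its CONSEQUENCES on the carriers `complexBetti`,
`classesSupportedOn`, `algebraicClasses`: for a smooth projective family `g : 𝒳 ⟶ V` of relative
dimension `n` over a smooth `ℂ`-scheme `V` (`Motives.IsSmoothProjectiveFamily`), a closed subscheme
`ι : 𝒲 ↪ 𝒳` FLAT over `V`, a complex point `v₀` and a decomposition of the SET of the fibre
`𝒲_{v₀} = W₀ ∪ C ⊆ X₀ := 𝒳_{v₀}` into an irreducible closed `W₀` of codimension exactly `p`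
(`Order.coheight`, as in `algebraicClasses`) not contained in the closed `C`, all of codimension `≥ p`
(so `W₀` is an irreducible component of `𝒲_{v₀}` of the expected codimension and `C` contains the
others): there is a global class `Γ ∈ H^{2p}(𝒳(ℂ); ℂ)` — classically `cl(𝒲)`, `𝒲` being of pure
codimension `p` in the smooth `𝒳` near `X₀` — such that (1) every fibre restriction `Γ|_{X_t}`
(`= cl[𝒲_t]`) is an algebraic class of codimension `p`, and (2) `Γ|_{X₀} = c₀ • w + y` with `c₀ ≠ 0`
(`= m_{W₀} ≥ 1`), `0 ≠ w` supported on `W₀` (`= cl(W₀)`, Lemma 19.1.1) and `y` supported on `C`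
(the other components). DICTIONARY: (1) is Prop. 10.1 (a) + Cor. 19.2 (b)/Ex. 19.2.1 at every `t` plus
"the class of a cycle is supported on its support, hence algebraic" (§19.1 (1)); (2) is the same at
`v₀` read through Lemma 19.1.1 (`H^{2p}_{W₀ ∪ C} = H^{2p}_{W₀} ⊕ H^{2p}_C` modulo the codimension
`> p` locus `W₀ ∩ C`, with `cl(W₀) ≠ 0`).
-- TODO(general form): the cycle-level statement `σ_t[𝒱] = [𝒱_t]` in `A_*(X_t)` (Prop. 10.1) and the
-- flat section `t ↦ cl[𝒲_t]` of `R^{2p} g_* ℂ` (Voisin II §9.2), once a cycle class map for families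
-- exists on real carriers.

## What is NOT here

No proof (named fact). No new definition besides the fact.
-/

noncomputable section

open CategoryTheory CategoryTheory.Limits AlgebraicGeometry

namespace Literature.AlgebraicGeometry.HodgeTheory

open Literature.AlgebraicGeometry.Motives

/-- **Specialisation of the cycle class of a flat family, with a non-zero coefficient on a component of
the expected codimension (Fulton 1998, Prop. 10.1 (a), Cor. 10.1, Cor. 19.2 (b), Lemma 19.1.1).**
PRINTED: for `𝒱 ⊆ 𝒳` a closed subscheme flat over the base and `t` a regular point, the
specialisation of `[𝒱]` is `[𝒱_t] = Σ_D length(𝒪_{𝒱_t,D}) [D]` (sum over the irreducible components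
of the fibre, all coefficients `≥ 1`), and `cl` is compatible with specialisation along the regular
embedding `X_t ↪ 𝒳`; `H^{2p}(X, X ∖ Z)` is freely spanned by the classes of the codimension-`p`
components of `Z`. RENDERING (module docstring): for a smooth projective family `g : 𝒳 ⟶ V` of
relative dimension `n` over a smooth `V`, `ι : 𝒲 ↪ 𝒳` closed and flat over `V`, `v₀ ∈ V(ℂ)`, and
closed `W₀, C ⊆ X₀ = 𝒳_{v₀}` with `𝒲_{v₀} = W₀ ∪ C` as sets, `W₀` irreducible of codimension exactly
`p` and not inside `C`, all points of `W₀ ∪ C` of codimension `≥ p`: there are a global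
`Γ ∈ H^{2p}(𝒳(ℂ); ℂ)`, a class `w ≠ 0` on `X₀` supported on `W₀` and `c₀ ≠ 0` with `Γ|_{X_t}`
algebraic for every `t ∈ V(ℂ)` and `Γ|_{X₀} - c₀ • w` supported on `C`.
[cite: Fulton1998, §10.1 Prop. 10.1 (a) and Cor. 10.1; §19.1 eq. (1) and Lemma 19.1.1; §19.2 Cor. 19.2 (b) and Example 19.2.1]
[cite: BuchweitzFlenner2003, §5, end of the proof of Thm. 5.1 (the fibre classes of the S-flat family are restrictions of one class)]
[cite: VoisinHodgeII2003, §9.2] -/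
def fulton1998_flatFamily_cycleClass_specialises : Prop :=
  ∀ ⦃n p : ℕ⦄ ⦃𝒳 V : SchemeOver ℂ⦄ (g : 𝒳 ⟶ V), IsSmoothProjectiveFamily g n →
    AlgebraicGeometry.Smooth V.hom →
    ∀ (𝒲 : Scheme) (ι : 𝒲 ⟶ 𝒳.left), IsClosedImmersion ι → Flat (ι ≫ g.left) →
    ∀ (v₀ : ComplexPoints V) (W₀ C : Set (fiberOver g v₀).left),
    IsClosed W₀ → IsIrreducible W₀ → IsClosed C →
    Set.range (pullback.snd ι (fiberι g v₀).left).base = W₀ ∪ C → ¬ (W₀ ⊆ C) →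
    (∀ z ∈ W₀ ∪ C, (p : ℕ∞) ≤ Order.coheight z) → (∃ z ∈ W₀, Order.coheight z = p) →
    ∃ (Γ : complexBetti 𝒳 (2 * p)) (w : complexBetti (fiberOver g v₀) (2 * p)) (c₀ : ℂ),
      (∀ t : ComplexPoints V,
        complexBetti.map (fiberι g t) (2 * p) Γ ∈ algebraicClasses (fiberOver g t) p) ∧
      w ∈ classesSupportedOn (fiberOver g v₀) W₀ (2 * p) ∧ w ≠ 0 ∧ c₀ ≠ 0 ∧
      complexBetti.map (fiberι g v₀) (2 * p) Γ - c₀ • w ∈ classesSupportedOn (fiberOver g v₀) C (2 * p)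

end Literature.AlgebraicGeometry.HodgeTheory

end
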